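import Summits.ValiantsHypothesis.ValiantsHypothesis.Theorems.TwoProducts.RankTwoJacobianTowerExceptional

/-!
# Rank-two Jacobian, P4c: Stage C (ii) — SPECIAL directions `Spec`, the index `idx`, gaps of `Xc`, and `card_Spec_le`

`Spec`, `idx`, `gap_of_idx_eq`, `lead_eq_of_gap`, `sameSign`, `wt_mul_of_onAxis`, `eq_of_onAxis_coord`, `axisPoint_eq`, `utop_between`, `spec_fibre_le_two`, ★ `card_Spec_le`
(the special set has `≤ 2(|Xc|+1)` elements).

P4 «TowerKernel» port (val-lit-p3 g18, desk #461 (D)/#465 (C); critic of record val-idea-crit-8 g3 CONTENT GO 03:36:15Z, VERDICT #38 «K13 K1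
`rankTwoCompositionLaw` KERNEL ✓») of `section TowerKernel` (l.645–1593) of val-idea-35 g9's crux workfile `Cruxes/TwoProducts/RankTwoJacobian_val_idea_35_g9.lean`
@a021fde990ed (sha16 2c954d16062836ab, 1595 l., 0 sorry) — bodies VERBATIM, namespace `…Cruxes.TwoProducts.ValIdea35g9` → `…Theorems.TwoProducts.RankTwoJacobian`,
split at the Stage seams for the 400-line lint (TowerCharts = charts + Stage A; TowerExceptional = Stage C up to `Eset`; TowerSpecials = Stage C from `Spec`;
TowerInduction = Stages D + B; Tower = Stage E + K1), one-line docstrings added where the workfile had none; over ✓ P1–P3 `…RankTwoJacobian{,Ostrowski,Axial}`.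
HONEST LABEL: K13 K1 = the decided sub-class «affine table rank ≤ 2» of the SIDE ladder «table-rank-ladder» of crux `stmt-ValiantsHypothesis-5906` (`TwoProducts`);
0 distance on `ResidualLawV25`; nothing here closes 5906 / `PlanarCellBound`; VP ≠ VNP is NOT proved.  `--supports stmt-ValiantsHypothesis-5906 --as helper`.
Credit: val-idea-35 g9 (everything).  No instances, no notation, no named facts. [folklore]
-/

noncomputable section
set_option linter.dupNamespace false

namespace Summit.ValiantsHypothesis.ValiantsHypothesis.Theorems.TwoProducts.RankTwoJacobian

open scoped BigOperators Pointwise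
open MvPolynomial

section TowerKernel
open scoped Classical

/-- special chart values of `F` relative to `w` (outside the exceptional set) -/
def Spec (σ : ℝ) (w F : Poly2) : Finset ℝ :=
  (EV σ F).filter (fun μ => μ ∉ Xc σ w ∧ ∃ e, IsAxialLead (dir σ μ) w e ∧ IsSpecial (dir σ μ) F e)

/-- gap index -/
def idx (σ : ℝ) (w : Poly2) (μ : ℝ) : ℕ := ((Xc σ w).filter (fun z => z < μ)).card

/-- `idx ≤ |Xc|`. [folklore] -/
theorem idx_le (σ : ℝ) (w : Poly2) (μ : ℝ) : idx σ w μ ≤ (Xc σ w).card := Finset.card_filter_le _ _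

/-- Equal indices ⇒ no point of `Xc` in `[x, y)`. [folklore] -/
theorem gap_of_idx_eq {σ : ℝ} {w : Poly2} {x y : ℝ} (_hxy : x < y) (h : idx σ w x = idx σ w y) :
    ∀ z ∈ Xc σ w, ¬ (x < z ∧ z < y) := by
  rintro z hz ⟨hxz, hzy⟩
  have hsub : (Xc σ w).filter (fun z => z < x) ⊂ (Xc σ w).filter (fun z => z < y) := by
    rw [Finset.ssubset_iff_of_subset]
    · exact ⟨z, Finset.mem_filter.mpr ⟨hz, hzy⟩, fun h => by
        have := (Finset.mem_filter.mp h).2; linarith⟩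
    · intro u hu
      obtain ⟨hu1, hu2⟩ := Finset.mem_filter.mp hu
      exact Finset.mem_filter.mpr ⟨hu1, by linarith⟩
  have := Finset.card_lt_card hsub
  unfold idx at h
  omega

/-- On a gap of `Xc` the axial lead is constant. [folklore] -/
theorem lead_eq_of_gap {σ : ℝ} (hσ : σ = 1 ∨ σ = -1) {w : Poly2} {x y : ℝ} (hxy : x < y)
    (hgap : ∀ z ∈ Xc σ w, ¬ (x < z ∧ z < y)) {e e' : Expo} (he : IsUTop (dir σ x) (S1 w) e)
    (he' : IsUTop (dir σ y) (S1 w) e') : e = e' := by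
  by_contra hne
  obtain ⟨μ, h1, h2, htie⟩ := exists_tie_between hσ (S1 w) hxy he he' hne
  exact hgap μ (tie_mem_Xc hσ htie) ⟨h1, h2⟩

/-- On a gap of `Xc` the lead weight keeps its sign. [folklore] -/
theorem sameSign {σ : ℝ} {w : Poly2} {x y : ℝ} (hxy : x < y)
    (hgap : ∀ z ∈ Xc σ w, ¬ (x < z ∧ z < y)) {e : Expo} (heS : e ∈ S1 w)
    (hx : wt (dir σ x) e ≠ 0) (_hy : wt (dir σ y) e ≠ 0) :
    (0 < wt (dir σ x) e ↔ 0 < wt (dir σ y) e) := by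
  by_cases he0 : e 0 = 0
  · -- weight is constant in the chart
    have : wt (dir σ x) e = wt (dir σ y) e := by rw [wt_dir, wt_dir, he0]; simp
    rw [this]
  · set z := -σ * ((e 1 : ℕ) : ℝ) / ((e 0 : ℕ) : ℝ) with hz
    have hzX : z ∈ Xc σ w := axis_mem_Xc heS he0
    have fx := wt_lead_factor σ x he0
    have fy := wt_lead_factor σ y he0
    have he0pos : (0 : ℝ) < ((e 0 : ℕ) : ℝ) := by
      have : 0 < e 0 := Nat.pos_of_ne_zero he0
      exact_mod_cast this
    constructor
    · intro hxpos
      -- x > z, hence y > z, hence wt_y > 0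
      have hxz : z < x := by
        by_contra h; push Not at h
        have : wt (dir σ x) e ≤ 0 := by rw [fx]; exact mul_nonpos_of_nonneg_of_nonpos he0pos.le (by linarith)
        linarith
      rw [fy]; exact mul_pos he0pos (by linarith)
    · intro hypos
      have hzy : z < y := by
        by_contra h; push Not at h
        have : wt (dir σ y) e ≤ 0 := by rw [fy]; exact mul_nonpos_of_nonneg_of_nonpos he0pos.le (by linarith)
        linarith
      -- if wt_x ≤ 0 then x ≤ z, and x ≠ z... : x < z < y contradicts the gap (x = z impossible as wt_x ≠ 0)
      by_contra hxnp; push Not at hxnp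
      have hxz : x < z := by
        rcases lt_trichotomy x z with h | h | h
        · exact h
        · exfalso; apply hx; rw [fx, h]; ring
        · exfalso
          have : 0 < wt (dir σ x) e := by rw [fx]; exact mul_pos he0pos (by linarith)
          linarith
      exact hgap z hzX ⟨hxz, hzy⟩

/-- Weights of points on a common axis are proportional. [folklore] -/
theorem wt_mul_of_onAxis (ν : Fin 2 → ℝ) {a e : Expo} (h : OnAxis a e) (i : Fin 2) :
    wt ν a * ((e i : ℕ) : ℝ) = ((a i : ℕ) : ℝ) * wt ν e := by
  unfold OnAxis at h
  have hr : ((a 0 : ℕ) : ℝ) * ((e 1 : ℕ) : ℝ) = ((a 1 : ℕ) : ℝ) * ((e 0 : ℕ) : ℝ) := by exact_mod_cast h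
  unfold wt
  fin_cases i
  · simp only [Fin.zero_eta, Fin.isValue]; linear_combination (-(ν 1)) * hr
  · simp only [Fin.mk_one, Fin.isValue]; linear_combination (ν 0) * hr

/-- Two points on the axis of `e` with one equal coordinate are equal. [folklore] -/
theorem eq_of_onAxis_coord {a a' e : Expo} (ha : OnAxis a e) (ha' : OnAxis a' e) {i : Fin 2}
    (hei : e i ≠ 0) (hi : a i = a' i) : a = a' := by
  unfold OnAxis at ha ha'
  fin_cases i
  · -- e 0 ≠ 0, a 0 = a' 0 ⇒ a 1 e0 = a0 e1 = a'0 e1 = a'1 e0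
    simp only [Fin.zero_eta, Fin.isValue] at hei hi
    refine expo_eq_of_coords hi ?_
    have h : ((a 1 : ℕ) : ℤ) * ((e 0 : ℕ) : ℤ) = ((a' 1 : ℕ) : ℤ) * ((e 0 : ℕ) : ℤ) := by
      rw [← ha, ← ha', hi]
    have he : ((e 0 : ℕ) : ℤ) ≠ 0 := by exact_mod_cast hei
    exact_mod_cast mul_right_cancel₀ he h
  · simp only [Fin.mk_one, Fin.isValue] at hei hi
    refine expo_eq_of_coords ?_ hi
    have h : ((a 0 : ℕ) : ℤ) * ((e 1 : ℕ) : ℤ) = ((a' 0 : ℕ) : ℤ) * ((e 1 : ℕ) : ℤ) := by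
      rw [ha, ha', hi]
    have he : ((e 1 : ℕ) : ℤ) ≠ 0 := by exact_mod_cast hei
    exact_mod_cast mul_right_cancel₀ he h

/-- on one gap, all specials share their axis point -/
theorem axisPoint_eq {σ : ℝ} {w F : Poly2} {x y : ℝ} (hxy : x < y)
    (hgap : ∀ z ∈ Xc σ w, ¬ (x < z ∧ z < y)) {e : Expo} (hex : IsAxialLead (dir σ x) w e)
    (hey : IsAxialLead (dir σ y) w e) {a a' : Expo} (ha : OnAxis a e) (ha' : OnAxis a' e)
    (haS : a ∈ F.support) (ha'S : a' ∈ F.support)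
    (hatop : ∀ r ∈ F.support, wt (dir σ x) r ≤ wt (dir σ x) a)
    (ha'top : ∀ r ∈ F.support, wt (dir σ y) r ≤ wt (dir σ y) a') : a = a' := by
  obtain ⟨heS, he0, hWx, -⟩ := hex
  obtain ⟨-, -, hWy, -⟩ := hey
  have heS1 : e ∈ S1 w := mem_S1.mpr ⟨heS, he0⟩
  have hsign := sameSign hxy hgap heS1 hWx hWy
  -- pick a coordinate i with e i ≠ 0
  have hei : ∃ i : Fin 2, e i ≠ 0 := by
    by_contra h; push Not at h
    exact he0 (expo_eq_of_coords (by simpa using h 0) (by simpa using h 1))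
  obtain ⟨i, hei⟩ := hei
  have heipos : (0 : ℝ) < ((e i : ℕ) : ℝ) := by
    have : 0 < e i := Nat.pos_of_ne_zero hei; exact_mod_cast this
  have m1 := wt_mul_of_onAxis (dir σ x) ha i
  have m1' := wt_mul_of_onAxis (dir σ x) ha' i
  have m2 := wt_mul_of_onAxis (dir σ y) ha i
  have m2' := wt_mul_of_onAxis (dir σ y) ha' i
  have i1 := hatop a' ha'S   -- wt_x a' ≤ wt_x a
  have i2 := ha'top a haS    -- wt_y a ≤ wt_y a'
  -- multiply by e_i > 0:  a'_i W_x ≤ a_i W_x  and  a_i W_y ≤ a'_i W_y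
  have j1 : ((a' i : ℕ) : ℝ) * wt (dir σ x) e ≤ ((a i : ℕ) : ℝ) * wt (dir σ x) e := by
    rw [← m1, ← m1']; exact mul_le_mul_of_nonneg_right i1 heipos.le
  have j2 : ((a i : ℕ) : ℝ) * wt (dir σ y) e ≤ ((a' i : ℕ) : ℝ) * wt (dir σ y) e := by
    rw [← m2, ← m2']; exact mul_le_mul_of_nonneg_right i2 heipos.le
  have hcoord : ((a i : ℕ) : ℝ) = ((a' i : ℕ) : ℝ) := by
    rcases lt_or_gt_of_ne hWx with hneg | hpos
    · have hneg' : wt (dir σ y) e < 0 := by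
        rcases lt_or_gt_of_ne hWy with h | h
        · exact h
        · exact absurd (hsign.mpr h) (not_lt.mpr hneg.le)
      have k1 : ((a i : ℕ) : ℝ) ≤ ((a' i : ℕ) : ℝ) := by nlinarith
      have k2 : ((a' i : ℕ) : ℝ) ≤ ((a i : ℕ) : ℝ) := by nlinarith
      linarith
    · have hpos' : 0 < wt (dir σ y) e := hsign.mp hpos
      have k1 : ((a' i : ℕ) : ℝ) ≤ ((a i : ℕ) : ℝ) := le_of_mul_le_mul_right j1 hpos
      have k2 : ((a i : ℕ) : ℝ) ≤ ((a' i : ℕ) : ℝ) := le_of_mul_le_mul_right j2 hpos'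
      linarith
  have : a i = a' i := by exact_mod_cast hcoord
  exact eq_of_onAxis_coord ha ha' hei this

/-- C4: a point that is a top at two chart values is the UNIQUE top strictly in between -/
theorem utop_between {σ : ℝ} (hσ : σ = 1 ∨ σ = -1) {F : Poly2} {x m y : ℝ} (hxm : x < m) (hmy : m < y)
    {a : Expo} (haS : a ∈ F.support) (hx : ∀ r ∈ F.support, wt (dir σ x) r ≤ wt (dir σ x) a)
    (hy : ∀ r ∈ F.support, wt (dir σ y) r ≤ wt (dir σ y) a) : IsUTop (dir σ m) F.support a := by
  refine ⟨haS, fun r hr hra => ?_⟩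
  have e1 := wt_sub_eq σ x r a
  have e2 := wt_sub_eq σ m r a
  have e3 := wt_sub_eq σ y r a
  have g1 : wt (dir σ x) r - wt (dir σ x) a ≤ 0 := sub_nonpos.mpr (hx r hr)
  have g3 : wt (dir σ y) r - wt (dir σ y) a ≤ 0 := sub_nonpos.mpr (hy r hr)
  set A := ((r 0 : ℕ) : ℝ) - ((a 0 : ℕ) : ℝ) with hA
  set B := σ * (((r 1 : ℕ) : ℝ) - ((a 1 : ℕ) : ℝ)) with hB
  by_contra hge; push Not at hge
  have g2 : 0 ≤ wt (dir σ m) r - wt (dir σ m) a := sub_nonneg.mpr hge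
  -- x A + B ≤ 0, y A + B ≤ 0, m A + B ≥ 0 with x < m < y ⇒ A = 0 and B = 0
  have hA0 : A = 0 := by
    rcases lt_trichotomy A 0 with h | h | h
    · nlinarith
    · exact h
    · nlinarith
  have hB0 : B = 0 := by rw [e2, hA0] at g2; rw [e1, hA0] at g1; linarith
  have h0 : r 0 = a 0 := by
    have : ((r 0 : ℕ) : ℝ) = ((a 0 : ℕ) : ℝ) := by linarith
    exact_mod_cast this
  have h1 : r 1 = a 1 := by
    have : σ * (((r 1 : ℕ) : ℝ) - ((a 1 : ℕ) : ℝ)) = 0 := hB0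
    rcases mul_eq_zero.mp this with h | h
    · exact absurd h (sigma_ne_zero hσ)
    · have : ((r 1 : ℕ) : ℝ) = ((a 1 : ℕ) : ℝ) := by linarith
      exact_mod_cast this
  exact hra (expo_eq_of_coords h0 h1)

/-- at most two specials per gap -/
theorem spec_fibre_le_two {σ : ℝ} (hσ : σ = 1 ∨ σ = -1) (w F : Poly2) (b : ℕ) :
    ((Spec σ w F).filter (fun μ => idx σ w μ = b)).card ≤ 2 := by
  by_contra h3; push Not at h3
  set f := (Spec σ w F).filter (fun μ => idx σ w μ = b) with hf
  have hne : f.Nonempty := Finset.card_pos.mp (by omega)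
  set x := f.min' hne with hx
  set y := f.max' hne with hy
  have hxf : x ∈ f := Finset.min'_mem f hne
  have hyf : y ∈ f := Finset.max'_mem f hne
  have hcard : ((f.erase x).erase y).card ≥ 1 := by
    have h1 := Finset.card_erase_of_mem hxf
    have h2 : ((f.erase x).erase y).card ≥ (f.erase x).card - 1 := by
      by_cases hy' : y ∈ f.erase x
      · rw [Finset.card_erase_of_mem hy']
      · rw [Finset.erase_eq_of_notMem hy']; omega
    omega
  obtain ⟨m, hm⟩ := Finset.card_pos.mp (by omega : 0 < ((f.erase x).erase y).card)
  have hmy : m ≠ y := Finset.ne_of_mem_erase hm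
  have hm' := Finset.mem_of_mem_erase hm
  have hmx : m ≠ x := Finset.ne_of_mem_erase hm'
  have hmf : m ∈ f := Finset.mem_of_mem_erase hm'
  have hxm : x < m := lt_of_le_of_ne (Finset.min'_le f m hmf) (Ne.symm hmx)
  have hmy' : m < y := lt_of_le_of_ne (Finset.le_max' f m hmf) hmy
  -- unpack the three specials
  have unpack : ∀ u ∈ f, idx σ w u = b ∧ u ∉ Xc σ w ∧
      ∃ e, IsAxialLead (dir σ u) w e ∧ IsSpecial (dir σ u) F e := by
    intro u hu
    obtain ⟨hu1, hu2⟩ := Finset.mem_filter.mp hu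
    obtain ⟨-, hu3, hu4⟩ := Finset.mem_filter.mp hu1
    exact ⟨hu2, hu3, hu4⟩
  obtain ⟨ix, -, ex, hlx, hsx⟩ := unpack x hxf
  obtain ⟨im, -, em, hlm, hsm⟩ := unpack m hmf
  obtain ⟨iy, -, ey, hly, hsy⟩ := unpack y hyf
  have gap_xm := gap_of_idx_eq hxm (ix.trans im.symm)
  have gap_my := gap_of_idx_eq hmy' (im.trans iy.symm)
  have exm : ex = em := lead_eq_of_gap hσ hxm gap_xm (lead_utop hlx) (lead_utop hlm)
  have emy : em = ey := lead_eq_of_gap hσ hmy' gap_my (lead_utop hlm) (lead_utop hly)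
  subst exm; subst emy
  obtain ⟨ax, haxS, hax, htx⟩ := special_axis_top hsx
  obtain ⟨am, hamS, ham, htm⟩ := special_axis_top hsm
  obtain ⟨ay, hayS, hay, hty⟩ := special_axis_top hsy
  have e1 : ax = am := axisPoint_eq hxm gap_xm hlx hlm hax ham haxS hamS htx htm
  have e2 : am = ay := axisPoint_eq hmy' gap_my hlm hly ham hay hamS hayS htm hty
  subst e1; subst e2
  have hu := utop_between hσ hxm hmy' haxS htx hty
  exact not_tie_of_utop hu (special_tie hsm)

/-- The special set has `≤ 2(|Xc|+1)` elements. [val-idea-35 g9] -/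
theorem card_Spec_le {σ : ℝ} (hσ : σ = 1 ∨ σ = -1) (w F : Poly2) :
    (Spec σ w F).card ≤ 2 * ((Xc σ w).card + 1) := by
  have h1 : (Spec σ w F).card ≤ 2 * ((Spec σ w F).image (idx σ w)).card :=
    Finset.card_le_mul_card_image _ 2 (fun b _ => spec_fibre_le_two hσ w F b)
  have h2 : ((Spec σ w F).image (idx σ w)).card ≤ (Xc σ w).card + 1 := by
    have hsub : (Spec σ w F).image (idx σ w) ⊆ Finset.range ((Xc σ w).card + 1) := by
      intro b hb
      obtain ⟨μ, -, rfl⟩ := Finset.mem_image.mp hb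
      exact Finset.mem_range.mpr (Nat.lt_succ_of_le (idx_le σ w μ))
    exact (Finset.card_le_card hsub).trans (by simp)
  calc (Spec σ w F).card ≤ 2 * ((Spec σ w F).image (idx σ w)).card := h1
    _ ≤ 2 * ((Xc σ w).card + 1) := Nat.mul_le_mul_left 2 h2



end TowerKernel

end Summit.ValiantsHypothesis.ValiantsHypothesis.Theorems.TwoProducts.RankTwoJacobian

end
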